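import Summits.HubbardSuperconductivity.HubbardSuperconductivity.Theorems.AnisotropyChordTransferFibre3B1Pointwise

/-!
# Route `AnisotropyChord` / H0 rotor rung, LEVEL 2 family B1: objects and per-factor torus lemmas of the GENERIC L-UNIFORM
BRACKET of near-dominated lattice sums

Memo ROTOR-THEORY-21 §311(b), family B1 (theory seat `hubbard-h0-rotor-theory-1` g21; LEVEL2-SPEC §3): the inputs
`S_p` (`p ≥ 2`), `Σ_k g(k)^a g(k+K₁)^b`, the convolutions `t(q) = Σ_p g(p)g(q−p)`, the `Π̂`-type triangles, … of the
Level-2 certificate are torus sums of finite products of shifted propagator powers,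
  `torSum L λ s a = Σ_{k ∈ (ℤ/L)²} Π_i g(k + s_i)^{a_i}`,  `g = gres L λ` (`= 1/(2ε(k) − λ)` off `0`, `0` at `0`),
of total degree `n = Σ_i a_i ≥ 2` (UV-convergent in lattice units, dominated by small momenta); «the same brackets applied
factorwise handle every B1 sum (shifted factors bracketed at m + m_ext)».
THIS FILE: the OBJECTS of the generic bracket — `toTor`, `box`, `nsq` (`|q|²`), `winE θ₀ q = Σ_c q_c²(1 − θ₀²q_c²/12)`
(xi2hi's summand), `tailConst ν K' n = (π²/4)ⁿ·π / (((K'+1)² − νπ²/4)^{n−2}·(K'² − νπ²/4))`, the index set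
`idx K S s = {p ∈ [−K−S, K+S]² : every p + s_i ∈ zWindow K}`, `torSum`, `loSum = Σ_{p ∈ idx} Π_i (|p + s_i|² − ν)^{−a_i}`,
`hiSum = Σ_{p ∈ idx} Π_i (W_{θ₀}(p + s_i) − ν)^{−a_i}`, the centred representative `rep`, the scaled shifted factor
`Xf ν t k = θ²·g(k + t)` (`θ = 2π/L`, `λ = νθ²`) — and the PER-FACTOR TORUS LEMMAS: `Xf_nonneg`, `Xf_eq_of_lift`,
`Xf_lower` (`1/(|q|² − ν) ≤ X`), `Xf_window` (`X ≤ 1/(W_{θ₀}(q) − ν)`), `Xf_tail` (Jordan at the centred representative),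
`rep_add_mem_tail` (the wrap step: a momentum with one shifted lift off the window has EVERY shifted representative in the
tail `|·|∞ > K − 2S`), `Xf_pow_tail`, `scaled_torSum_eq` (`θ^{2n}·torSum = Σ_k Π_i X_{s_i}(k)^{a_i}`).
The bracket theorem `b1Bracket` (`loSum ≤ θ^{2n}·torSum ≤ hiSum + tailConst`) is the sibling module `…Fibre3B1Bracket`.
Prover seat `hubbard-h0-rotor-p2` g4; helper for piece A = stmt-HubbardSuperconductivity-23918 of rung 19089
(`--supports`, helper class).  Nothing here proves superconductivity in the Hubbard model; helper lemmas of ONE conditional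
reduction (the GM₃ ∀L certificate, Level-2 rows); the rotor TARGET as originally worded stays FALSE (g15 verdict).
Mathlib + the tree only; no sorry.
-/

set_option linter.dupNamespace false
set_option autoImplicit false

noncomputable section

open scoped BigOperators

namespace Summit.HubbardSuperconductivity.HubbardSuperconductivity.Theorems.AnisotropyChord.Transfer.Fibre3.B1

variable (L : ℕ) [NeZero L]

/-! ## Objects -/

/-- an integer vector read on the torus `(ℤ/L)²`. -/
def toTor (p : ℤ × ℤ) : Tor L := ((((p.1 : ℤ)) : ZMod L), (((p.2 : ℤ)) : ZMod L))

/-- the box `[−M, M]² ⊂ ℤ²`. -/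
def box (M : ℕ) : Finset (ℤ × ℤ) := Finset.Icc (-(M : ℤ)) M ×ˢ Finset.Icc (-(M : ℤ)) M

/-- `|q|² = q₁² + q₂²` (real). -/
def nsq (q : ℤ × ℤ) : ℝ := ((q.1 : ℤ) : ℝ) ^ 2 + ((q.2 : ℤ) : ℝ) ^ 2

/-- the Taylor window energy `W_{θ₀}(q) = q₁²(1 − θ₀²q₁²/12) + q₂²(1 − θ₀²q₂²/12)` (the summand of PartN35's `xi2hi`). -/
def winE (θ0 : ℝ) (q : ℤ × ℤ) : ℝ :=
  ((q.1 : ℤ) : ℝ) ^ 2 * (1 - θ0 ^ 2 * ((q.1 : ℤ) : ℝ) ^ 2 / 12)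
    + ((q.2 : ℤ) : ℝ) ^ 2 * (1 - θ0 ^ 2 * ((q.2 : ℤ) : ℝ) ^ 2 / 12)

/-- the `ℤ²` tail constant of total degree `n` beyond `|p|∞ > K'`:
`(π²/4)ⁿ·π / (((K'+1)² − νπ²/4)^{n−2} · (K'² − νπ²/4))`. -/
def tailConst (ν : ℝ) (K' n : ℕ) : ℝ :=
  (Real.pi ^ 2 / 4) ^ n * Real.pi
    / ((((K' : ℝ) + 1) ^ 2 - ν * Real.pi ^ 2 / 4) ^ (n - 2) * ((K' : ℝ) ^ 2 - ν * Real.pi ^ 2 / 4))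

variable {ι : Type*} [Fintype ι]

/-- the common index set of the window sums: the integer vectors all of whose shifts lie in the punctured window
`zWindow K` (a subset of the box `[−K−S, K+S]²`). -/
def idx (K S : ℕ) (s : ι → ℤ × ℤ) : Finset (ℤ × ℤ) :=
  (box (K + S)).filter (fun p => ∀ i, p + s i ∈ zWindow K)

/-- the family-B1 torus sum `Σ_{k ∈ (ℤ/L)²} Π_i g(k + s_i)^{a_i}`, `g = gres L λ`. -/
def torSum (lam : ℝ) (s : ι → ℤ × ℤ) (a : ι → ℕ) : ℝ :=
  ∑ k : Tor L, ∏ i, gres L lam (k + toTor L (s i)) ^ a i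

/-- the LOWER window sum `Σ_{p ∈ idx} Π_i (|p + s_i|² − ν)^{−a_i}`. -/
def loSum (ν : ℝ) (K S : ℕ) (s : ι → ℤ × ℤ) (a : ι → ℕ) : ℝ :=
  ∑ p ∈ idx K S s, ∏ i, (1 / (nsq (p + s i) - ν)) ^ a i

/-- the UPPER window sum `Σ_{p ∈ idx} Π_i (W_{θ₀}(p + s_i) − ν)^{−a_i}`. -/
def hiSum (ν θ0 : ℝ) (K S : ℕ) (s : ι → ℤ × ℤ) (a : ι → ℕ) : ℝ :=
  ∑ p ∈ idx K S s, ∏ i, (1 / (winE θ0 (p + s i) - ν)) ^ a i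

/-- the centred representative of a momentum: `(valMinAbs k₁, valMinAbs k₂) ∈ (−L/2, L/2]²`. -/
def rep (k : Tor L) : ℤ × ℤ := ((k.1.valMinAbs : ℤ), (k.2.valMinAbs : ℤ))

/-- the scaled shifted factor `X_t(k) = θ²·g(k + t)`, `θ = 2π/L`, `λ = νθ²`. -/
def Xf (ν : ℝ) (t : ℤ × ℤ) (k : Tor L) : ℝ :=
  (2 * Real.pi / L) ^ 2 * gres L (ν * (2 * Real.pi / L) ^ 2) (k + toTor L t)

/-! ## Small lemmas on the objects -/

omit [NeZero L] in
/-- `toTor` is additive. [folklore] -/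
theorem toTor_add (p q : ℤ × ℤ) : toTor L (p + q) = toTor L p + toTor L q := by
  unfold toTor
  ext <;> simp

omit [NeZero L] in
/-- reading back the centred representative. [folklore] -/
theorem toTor_rep (k : Tor L) : toTor L ((k.1.valMinAbs : ℤ), (k.2.valMinAbs : ℤ)) = k :=
  intCast_rep L k

omit [NeZero L] in
/-- a coordinate of `toTor (rep k + s)`. [folklore] -/
theorem toTor_rep_add (k : Tor L) (t : ℤ × ℤ) :
    k + toTor L t = toTor L (((k.1.valMinAbs : ℤ), (k.2.valMinAbs : ℤ)) + t) := by
  unfold toTor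
  ext <;> simp [ZMod.coe_valMinAbs]

/-- membership in the box. [folklore] -/
theorem mem_box_iff (M : ℕ) (p : ℤ × ℤ) :
    p ∈ box M ↔ (-(M : ℤ) ≤ p.1 ∧ p.1 ≤ M) ∧ (-(M : ℤ) ≤ p.2 ∧ p.2 ≤ M) := by
  unfold box
  simp only [Finset.mem_product, Finset.mem_Icc]

/-- membership in the index set. [folklore] -/
theorem mem_idx_iff (K S : ℕ) (s : ι → ℤ × ℤ) (p : ℤ × ℤ) :
    p ∈ idx K S s ↔ p ∈ box (K + S) ∧ ∀ i, p + s i ∈ zWindow K := by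
  unfold idx
  rw [Finset.mem_filter]

/-- off the punctured window and off the origin means a large coordinate. [folklore] -/
theorem natAbs_gt_of_not_mem_zWindow (K : ℕ) (p : ℤ × ℤ) (hp0 : p ≠ (0, 0)) (h : p ∉ zWindow K) :
    K < p.1.natAbs ∨ K < p.2.natAbs := by
  have h' : ¬((-(K : ℤ) ≤ p.1 ∧ p.1 ≤ K) ∧ (-(K : ℤ) ≤ p.2 ∧ p.2 ≤ K)) :=
    fun hh => h ((mem_zWindow_iff K p).2 ⟨hp0, hh⟩)
  omega

/-- a real square bound from an integer window bound. [folklore] -/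
theorem sq_intCast_le (x : ℤ) (K : ℕ) (h1 : -(K : ℤ) ≤ x) (h2 : x ≤ K) : ((x : ℝ)) ^ 2 ≤ (K : ℝ) ^ 2 := by
  have h1' : -(K : ℝ) ≤ x := by exact_mod_cast h1
  have h2' : (x : ℝ) ≤ K := by exact_mod_cast h2
  exact sq_le_sq' h1' h2'

/-- a real square bound from an integer modulus bound. [folklore] -/
theorem sq_le_sq_intCast (x : ℤ) (M : ℕ) (h : M < x.natAbs) : ((M : ℝ) + 1) ^ 2 ≤ ((x : ℝ)) ^ 2 := by
  have h' : (M : ℤ) + 1 ≤ |x| := by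
    rw [← Int.natCast_natAbs]
    exact_mod_cast h
  have h'' : (M : ℝ) + 1 ≤ |(x : ℝ)| := by
    rw [← Int.cast_abs]
    exact_mod_cast h'
  have h0 : (0 : ℝ) ≤ (M : ℝ) + 1 := by positivity
  nlinarith [abs_nonneg (x : ℝ), sq_abs (x : ℝ), mul_le_mul h'' h'' h0 (abs_nonneg _)]

/-! ## Per-factor lemmas on the torus -/

/-- `4K ≤ L` from `2π/L ≤ θ₀` and `θ₀K ≤ π/2`. [folklore] -/
theorem four_mul_le_of_scales (θ0 : ℝ) (K : ℕ) (hθ0 : 2 * Real.pi / L ≤ θ0) (hθ0K : θ0 * K ≤ Real.pi / 2) :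
    4 * K ≤ L := by
  have hLpos : (0 : ℝ) < L := by exact_mod_cast Nat.pos_of_ne_zero (NeZero.ne L)
  have hKR : (0 : ℝ) ≤ K := by positivity
  have h1 : 2 * Real.pi / L * K ≤ Real.pi / 2 := le_trans (mul_le_mul_of_nonneg_right hθ0 hKR) hθ0K
  rw [div_mul_eq_mul_div, div_le_iff₀ hLpos] at h1
  have h3 : (4 * K : ℝ) ≤ L := by nlinarith [Real.pi_pos]
  exact_mod_cast h3

/-- `θK ≤ π/2` for `θ = 2π/L`, `4K ≤ L`. [folklore] -/
theorem theta_mul_le (K : ℕ) (h4K : 4 * K ≤ L) : 2 * Real.pi / L * K ≤ Real.pi / 2 := by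
  have hLpos : (0 : ℝ) < L := by exact_mod_cast Nat.pos_of_ne_zero (NeZero.ne L)
  have h : (4 * K : ℝ) ≤ L := by exact_mod_cast h4K
  rw [div_mul_eq_mul_div, div_le_iff₀ hLpos]
  nlinarith [Real.pi_pos]

/-- the scaled factors are nonnegative. [folklore] -/
theorem Xf_nonneg (ν : ℝ) (hν : ν < 4 / Real.pi ^ 2) (t : ℤ × ℤ) (k : Tor L) : 0 ≤ Xf L ν t k := by
  unfold Xf
  exact mul_nonneg (sq_nonneg _) (gres_nonneg L ν hν _)
/-- value of a scaled factor through an integer lift `q` of `k + t`. [folklore] -/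
theorem Xf_eq_of_lift (ν : ℝ) (t : ℤ × ℤ) (k : Tor L) (q : ℤ × ℤ) (h : k + toTor L t = toTor L q)
    (hq : toTor L q ≠ 0) :
    Xf L ν t k = (2 * Real.pi / L) ^ 2
      / ((2 * (1 - Real.cos (2 * Real.pi / L * ((q.1 : ℤ) : ℝ))) + 2 * (1 - Real.cos (2 * Real.pi / L * ((q.2 : ℤ) : ℝ))))
          - ν * (2 * Real.pi / L) ^ 2) := by
  unfold Xf gres
  rw [h, if_neg hq, mul_one_div]
  unfold toTor
  rw [two_epsT_intCast L q]

omit [NeZero L] in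
/-- the lower weight is nonnegative off the origin. [folklore] -/
theorem lo_nonneg (ν : ℝ) (hν : ν < 4 / Real.pi ^ 2) (q : ℤ × ℤ) (hq : q ≠ (0, 0)) : 0 ≤ 1 / (nsq q - ν) := by
  have h1 : (1 : ℝ) ≤ nsq q := one_le_sq_add_sq _ _ hq
  have hpi3 := Real.pi_gt_three
  have h2 : ν < 1 := lt_of_lt_of_le hν (by rw [div_le_one (by positivity)]; nlinarith)
  apply div_nonneg zero_le_one
  linarith

/-- LOWER per factor on the torus: `1/(|q|² − ν) ≤ X_t(k)` when `k + t` lifts to the window point `q`. [folklore] -/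
theorem Xf_lower (ν : ℝ) (hν : ν < 4 / Real.pi ^ 2) (K : ℕ) (h4K : 4 * K ≤ L) (t : ℤ × ℤ) (k : Tor L)
    (q : ℤ × ℤ) (hq : q ∈ zWindow K) (h : k + toTor L t = toTor L q) :
    1 / (nsq q - ν) ≤ Xf L ν t k := by
  have hLpos : (0 : ℝ) < L := by exact_mod_cast Nat.pos_of_ne_zero (NeZero.ne L)
  have hθpos : 0 < 2 * Real.pi / L := by positivity
  have hθK := theta_mul_le L K h4K
  have hq' := hq
  rw [mem_zWindow_iff] at hq'
  obtain ⟨hq0, ⟨h1a, h1b⟩, ⟨h2a, h2b⟩⟩ := hq'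
  have hL1 : 1 ≤ L := Nat.pos_of_ne_zero (NeZero.ne L)
  have hne : toTor L q ≠ 0 := intCast_ne_zero_of_mem_zWindow L K (by omega) q hq
  rw [Xf_eq_of_lift L ν t k q h hne]
  unfold nsq
  exact factor_lower _ ν _ _ hθpos hν (one_le_sq_add_sq _ _ hq0)
    (abs_angle_le_pi _ K hθpos hθK _ h1a h1b) (abs_angle_le_pi _ K hθpos hθK _ h2a h2b)

/-- positivity of the window weight denominator on the window. [folklore] -/
theorem hi_den_pos (ν : ℝ) (hν : ν < 4 / Real.pi ^ 2) (θ0 : ℝ) (K : ℕ) (hθ0 : 2 * Real.pi / L ≤ θ0)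
    (hθ0K : θ0 * K ≤ Real.pi / 2) (q : ℤ × ℤ) (hq : q ∈ zWindow K) : 0 < winE θ0 q - ν := by
  have hLpos : (0 : ℝ) < L := by exact_mod_cast Nat.pos_of_ne_zero (NeZero.ne L)
  have hθpos : 0 < 2 * Real.pi / L := by positivity
  have hθ0pos : 0 < θ0 := lt_of_lt_of_le hθpos hθ0
  rw [mem_zWindow_iff] at hq
  obtain ⟨hq0, ⟨h1a, h1b⟩, ⟨h2a, h2b⟩⟩ := hq
  unfold winE
  exact window_den_pos θ0 ν _ _ K hθ0pos (by positivity) hθ0K hν (one_le_sq_add_sq _ _ hq0)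
    (sq_intCast_le _ _ h1a h1b) (sq_intCast_le _ _ h2a h2b)

/-- WINDOW per factor on the torus: `X_t(k) ≤ 1/(W_{θ₀}(q) − ν)` when `k + t` lifts to the window point `q`. [folklore] -/
theorem Xf_window (ν : ℝ) (hν : ν < 4 / Real.pi ^ 2) (θ0 : ℝ) (K : ℕ) (hθ0 : 2 * Real.pi / L ≤ θ0)
    (hθ0K : θ0 * K ≤ Real.pi / 2) (t : ℤ × ℤ) (k : Tor L) (q : ℤ × ℤ) (hq : q ∈ zWindow K)
    (h : k + toTor L t = toTor L q) :
    Xf L ν t k ≤ 1 / (winE θ0 q - ν) := by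
  have hLpos : (0 : ℝ) < L := by exact_mod_cast Nat.pos_of_ne_zero (NeZero.ne L)
  have hθpos : 0 < 2 * Real.pi / L := by positivity
  have h4K := four_mul_le_of_scales L θ0 K hθ0 hθ0K
  have hq' := hq
  rw [mem_zWindow_iff] at hq'
  obtain ⟨hq0, ⟨h1a, h1b⟩, ⟨h2a, h2b⟩⟩ := hq'
  have hL1 : 1 ≤ L := Nat.pos_of_ne_zero (NeZero.ne L)
  have hne : toTor L q ≠ 0 := intCast_ne_zero_of_mem_zWindow L K (by omega) q hq
  rw [Xf_eq_of_lift L ν t k q h hne]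
  unfold winE
  exact factor_window _ θ0 ν _ _ K hθpos hθ0 (by positivity) hθ0K hν (one_le_sq_add_sq _ _ hq0)
    (sq_intCast_le _ _ h1a h1b) (sq_intCast_le _ _ h2a h2b)

/-- TAIL per factor on the torus: Jordan at the centred representative of `k + t ≠ 0`. [folklore] -/
theorem Xf_tail (ν : ℝ) (hν : ν < 4 / Real.pi ^ 2) (t : ℤ × ℤ) (k : Tor L) (hk : k + toTor L t ≠ 0) :
    Xf L ν t k ≤ Real.pi ^ 2 / 4 / (nsq (rep L (k + toTor L t)) - ν * Real.pi ^ 2 / 4) := by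
  have hLpos : (0 : ℝ) < L := by exact_mod_cast Nat.pos_of_ne_zero (NeZero.ne L)
  have hθpos : 0 < 2 * Real.pi / L := by positivity
  have hpi3 := Real.pi_gt_three
  have h1 : (1 : ℝ) ≤ nsq (rep L (k + toTor L t)) := by
    unfold nsq rep
    exact one_le_sq_add_sq _ _ (rep_ne_zero L hk)
  have hc1 : ν * Real.pi ^ 2 / 4 < 1 := by
    rw [div_lt_one (by norm_num)]
    have := (lt_div_iff₀ (by positivity)).mp hν
    linarith
  have hj := RateLemma.jordanEpsLower_holds L (k + toTor L t)
  have hj2 : 4 / Real.pi ^ 2 * (2 * Real.pi / L) ^ 2 * nsq (rep L (k + toTor L t))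
      ≤ 2 * epsT L (k + toTor L t) := by
    unfold nsq rep
    dsimp only
    have h4 : 4 / Real.pi ^ 2 * (2 * Real.pi / L) ^ 2
          * ((((k + toTor L t).1.valMinAbs : ℤ) : ℝ) ^ 2 + (((k + toTor L t).2.valMinAbs : ℤ) : ℝ) ^ 2)
        = 2 * (2 / Real.pi ^ 2 * (2 * Real.pi / L) ^ 2
          * ((((k + toTor L t).1.valMinAbs : ℤ) : ℝ) ^ 2 + (((k + toTor L t).2.valMinAbs : ℤ) : ℝ) ^ 2)) := by
      ring
    linarith [hj, h4]
  unfold Xf gres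
  rw [if_neg hk, mul_one_div]
  exact factor_tail _ ν _ _ hθpos (by linarith) hj2

/-- the WRAP step on the torus: if some shift `u` of `rep k` leaves the window `K` (off the origin), then every shift `t`
(`|t|∞, |u|∞ ≤ S`) has the centred representative of `k + t` outside `zWindow (K − 2S)`, with `|·|² ≥ (K − 2S + 1)²`. -/
theorem rep_add_mem_tail (K S : ℕ) (hK : 2 + 2 * S ≤ K) (h4K : 4 * K ≤ L) (k : Tor L) (t u : ℤ × ℤ)
    (ht : t.1.natAbs ≤ S ∧ t.2.natAbs ≤ S) (hu : u.1.natAbs ≤ S ∧ u.2.natAbs ≤ S)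
    (hu0 : rep L k + u ≠ (0, 0)) (hfar : rep L k + u ∉ zWindow K) (hne : k + toTor L t ≠ 0) :
    rep L (k + toTor L t) ∈ zWindow (L / 2) \ zWindow (K - 2 * S) ∧
      (((K - 2 * S : ℕ) : ℝ) + 1) ^ 2 ≤ nsq (rep L (k + toTor L t)) := by
  have hbig := natAbs_gt_of_not_mem_zWindow K _ hu0 hfar
  have hm : (rep L k).1.natAbs ≤ L / 2 := ZMod.natAbs_valMinAbs_le k.1
  have hm' : (rep L k).2.natAbs ≤ L / 2 := ZMod.natAbs_valMinAbs_le k.2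
  have hwrap : L / 2 + S + (K - 2 * S) < L := by omega
  have hc1 : (k + toTor L t).1 = ((((rep L k).1 + t.1 : ℤ)) : ZMod L) := by
    unfold rep toTor; simp [ZMod.coe_valMinAbs]
  have hc2 : (k + toTor L t).2 = ((((rep L k).2 + t.2 : ℤ)) : ZMod L) := by
    unfold rep toTor; simp [ZMod.coe_valMinAbs]
  have hmemN : rep L (k + toTor L t) ∈ zWindow (L / 2) := rep_mem_zWindow L hne
  simp only [Prod.fst_add, Prod.snd_add] at hbig
  obtain ⟨ht1, ht2⟩ := ht
  obtain ⟨hu1, hu2⟩ := hu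
  rcases hbig with hb | hb
  · have hgt : K - 2 * S < ((rep L k).1 + t.1).natAbs := by omega
    have hle : ((rep L k).1 + t.1).natAbs ≤ L / 2 + S := by omega
    have key := natAbs_valMinAbs_intCast_gt L ((rep L k).1 + t.1) (K - 2 * S) S hle hgt hwrap
    rw [← hc1] at key
    refine ⟨Finset.mem_sdiff.mpr ⟨hmemN, fun hmem => ?_⟩, ?_⟩
    · rw [mem_zWindow_iff] at hmem
      have h' := hmem.2.1
      unfold rep at h'
      omega
    · have hsq := sq_le_sq_intCast ((k + toTor L t).1.valMinAbs) (K - 2 * S) key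
      unfold nsq rep
      nlinarith [sq_nonneg ((((k + toTor L t).2.valMinAbs : ℤ)) : ℝ)]
  · have hgt : K - 2 * S < ((rep L k).2 + t.2).natAbs := by omega
    have hle : ((rep L k).2 + t.2).natAbs ≤ L / 2 + S := by omega
    have key := natAbs_valMinAbs_intCast_gt L ((rep L k).2 + t.2) (K - 2 * S) S hle hgt hwrap
    rw [← hc2] at key
    refine ⟨Finset.mem_sdiff.mpr ⟨hmemN, fun hmem => ?_⟩, ?_⟩
    · rw [mem_zWindow_iff] at hmem
      have h' := hmem.2.2
      unfold rep at h'
      omega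
    · have hsq := sq_le_sq_intCast ((k + toTor L t).2.valMinAbs) (K - 2 * S) key
      unfold nsq rep
      nlinarith [sq_nonneg ((((k + toTor L t).1.valMinAbs : ℤ)) : ℝ)]

/-- TAIL power bound: `X_t(k)ⁿ ≤ Bc^{n−2}·Jt(rep(k+t))²` once `|rep(k+t)|² ≥ (K'+1)²`. [folklore] -/
theorem Xf_pow_tail (ν : ℝ) (hν : ν < 4 / Real.pi ^ 2) (t : ℤ × ℤ) (k : Tor L)
    (hk : k + toTor L t ≠ 0) (n K' : ℕ) (h2 : 2 ≤ n)
    (hsq : ((K' : ℝ) + 1) ^ 2 ≤ nsq (rep L (k + toTor L t))) :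
    Xf L ν t k ^ n ≤ (Real.pi ^ 2 / 4 / (((K' : ℝ) + 1) ^ 2 - ν * Real.pi ^ 2 / 4)) ^ (n - 2)
      * (Real.pi ^ 2 / 4 / (nsq (rep L (k + toTor L t)) - ν * Real.pi ^ 2 / 4)) ^ 2 := by
  have hpi3 := Real.pi_gt_three
  have hc1 : ν * Real.pi ^ 2 / 4 < 1 := by
    rw [div_lt_one (by norm_num)]
    have := (lt_div_iff₀ (by positivity)).mp hν
    linarith
  have hK'0 : (0 : ℝ) ≤ K' := by positivity
  have hD1 : 0 < ((K' : ℝ) + 1) ^ 2 - ν * Real.pi ^ 2 / 4 := by nlinarith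
  apply pow_le_pow_mul_sq _ _ _ n h2 (Xf_nonneg L ν hν t k) (Xf_tail L ν hν t k hk)
  exact div_le_div_of_nonneg_left (by positivity) hD1 (by linarith)


/-- the middle quantity as a sum of products of scaled factors. [folklore] -/
theorem scaled_torSum_eq (ν : ℝ) (s : ι → ℤ × ℤ) (a : ι → ℕ) (n : ℕ) (hn : ∑ i, a i = n) :
    (2 * Real.pi / L) ^ (2 * n) * torSum L (ν * (2 * Real.pi / L) ^ 2) s a
      = ∑ k : Tor L, ∏ i, Xf L ν (s i) k ^ a i := by
  unfold torSum Xf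
  rw [Finset.mul_sum]
  refine Finset.sum_congr rfl fun k _ => ?_
  simp_rw [mul_pow]
  rw [Finset.prod_mul_distrib, Finset.prod_pow_eq_pow_sum, ← pow_mul, hn]

end Summit.HubbardSuperconductivity.HubbardSuperconductivity.Theorems.AnisotropyChord.Transfer.Fibre3.B1

end
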